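import Summits.SmoothPoincare4.SmoothPoincare4.Theorems.ConvexBisectionAcyclicBisectionExistsBeltCoreTwistingLoop
import Summits.SmoothPoincare4.SmoothPoincare4.Theorems.ConvexBisectionAcyclicBisectionExistsBeltTubePushoff
import Summits.SmoothPoincare4.SmoothPoincare4.Theorems.ConvexBisectionAcyclicBisectionExistsPageInvariance
import HarnessLib

/-!
# The page twisting of the one-twist fibre framing of the core of a page tube, II: the computation
(node T3c-1 `node_belt_isotopic_pushoff` of the sub-goal T3 of stub `stub_steinRealisation` (NF6), line
`modp-braid-orbits`, crux `ConvexBisection.AcyclicBisectionExists`, item stmt-SmoothPoincare4-10508;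
wave 4, worker Y2, lead c5; bookkeeping (4) of stage (3d), the text agreed with the assembler Y1)

Continuation of `…BeltCoreTwistingLoop.lean`.  For Z4's page tube `Φ` around a smoothly embedded page curve
`K ⊂ page g c` (CORE clause `Φ (ψ, 0) = K ψ`, FIBRE DERIVATIVE clause
`d/dv|₀ Φ (e^{2πiτ}, v) = v₀ · a · iK'(τ) + v₁ · κ · rot (K (e^{2πiτ}))`, `a, κ > 0`), a slide direction `b`
and a sign `s = ±1`:

* §3 (continued) the twisting loop of `(K ∘ uDir b, d/dε|₀ Φ (uDir b θ, ε reflFibre s θ))` is the ellipse-like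
  loop with `A = a ‖K'‖²`, `B = κ ⟪rot, iK'⟫`, `D = κ ‖w‖²/‖dΦ‖²` (`pageTwistingLoop_core`: the ambient framing
  vector `ambient_coreFraming`, the velocity `σ_b K'(σ_b t)`, `⟪iK', n⟫ = 0`, `⟪rot, n⟫ = ‖w‖²/‖dΦ‖²`), hence
  **the page twisting is `s · σ_b`** (`pageTwisting_core`, by `wind_ellipseLike`);
* §3b riders read directly at a push-off `θ ↦ Φ (uDir b θ, d e₁)` (`|d| < 1`) of Z4's page tube: its homology
  shadow is `± shadow K` (sign `b`; radial family to the core, `shadow_eq_of_family`, `shadow_eq_neg_of_reverse`),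
  and — given Z4's PAGES clause — the page twisting of its fibre framing `d/dε|₀ Φ (uDir b θ, d e₁ + ε reflFibre s θ)`
  is again `s · σ_b` (`pageTwisting_pushoff`: the radial family of push-offs consists of smoothly embedded page
  curves with framings, `tubeCurveIsotopy`/`isFramingAlong_tubeCurve` of Z5, so no twisting loop vanishes,
  `pageTwistingLoop_ne_zero_of_isKnotFraming`, and `pageTwisting_eq_of_bundle_family` reduces to the core);
* §4 the registered helper `helper_belt_coreTwisting` (Y1's `Stage4TwistStatement`, verbatim).

Everything is proved; no named facts.

## References
* J. B. Etnyre, T. Fuller, *Realizing 4-manifolds as achiral Lefschetz fibrations*, IMRN 2006, §2. [EtnyreFuller2006]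
-/

noncomputable section

-- the prescribed namespace `Summit.<P>.<Sub>.…` duplicates `SmoothPoincare4` (P = Sub)
set_option linter.dupNamespace false

open scoped Manifold ContDiff Topology Real ComplexConjugate
open Set Function Metric

namespace Summit.SmoothPoincare4.SmoothPoincare4.Theorems.AcyclicBisectionExists.ModpBraidOrbits

open Literature.Topology.FourManifolds Literature.Topology.FourManifolds.LefschetzBase
  Literature.Geometry.Symplectic Literature.Topology.PlaneTopology

variable {g : ℕ} {K : sphere (0 : EuclideanSpace ℝ (Fin 2)) 1 → Base g}

/-! ### §3 (continued) The twisting loop and the page twisting at the core -/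

/-- **The twisting loop of the fibre framing of the re-parametrised core is ellipse-like**: with
`τ = σ_b t`, `T = K'(τ)`, `q = K(e^{2πiτ})`, it is
`(σ_b (a ‖T‖² cos 2πt + s κ ⟪rot q, iT⟫ sin 2πt), s κ (‖w q‖²/‖dΦ_q‖²) sin 2πt)`. [cite: EtnyreFuller2006, §2] -/
theorem pageTwistingLoop_core {c : ℂ} (hc : ‖c‖ = 1) (hK : Manifold.IsSmoothEmbedding (𝓡 1) (𝓡∂ 4) ∞ K)
    (hKc : ∀ θ, K θ ∈ page g c) (Φ : CircleTube (bBase g).carrier) (hcore : ∀ ψ, (bBase g).incl (Φ.core ψ) = K ψ)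
    {κ a : ℝ} (hder : ∀ t : ℝ, HasFDerivAt (fun v : EuclideanSpace ℝ (Fin 2) =>
        ((bBase g).incl (Φ.toHomeo (circlePt t, v))).1)
      ((EuclideanSpace.proj (𝕜 := ℝ) (0 : Fin 2)).smulRight (a • cplxJ (deriv (ambCurve g K) t)) +
        (EuclideanSpace.proj (𝕜 := ℝ) (1 : Fin 2)).smulRight (κ • rotField g (K (circlePt t)).1)) 0)
    (b : Bool) (s t : ℝ) :
    pageTwistingLoop g (fun θ => K (uDir b θ))
        (fun θ => mfderiv 𝓘(ℝ, ℝ) (𝓡∂ 4) (fun ε : ℝ => (bBase g).incl (Φ.toHomeo (uDir b θ,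
          ε • reflFibre s (θ : EuclideanSpace ℝ (Fin 2))))) 0 (1 : ℝ)) t =
      (⟨slideSign b * (a * ‖deriv (ambCurve g K) (slideSign b * t)‖ ^ 2 * Real.cos (2 * π * t) +
          s * (κ * inner ℝ (rotField g (ambCurve g K (slideSign b * t)))
            (cplxJ (deriv (ambCurve g K) (slideSign b * t)))) * Real.sin (2 * π * t)),
        s * (κ * (‖w g (ambCurve g K (slideSign b * t))‖ ^ 2 /
          (‖dPhiX g (ambCurve g K (slideSign b * t))‖ ^ 2 + ‖dPhiY (ambCurve g K (slideSign b * t))‖ ^ 2))) *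
          Real.sin (2 * π * t)⟩ : ℂ) := by
  have hamb := ambient_coreFraming Φ hcore hder b s t
  have hvel := deriv_ambCurve_comp_uDir (g := g) (K := K) b t
  have hpt : ambCurve g (fun θ => K (uDir b θ)) t = ambCurve g K (slideSign b * t) := by rw [ambCurve_comp_uDir]
  have hKd := contDiff_ambCurve_top (g := g) hK.contMDiff
  have hTq := dPhi_velocity_eq_zero_of_page (g := g) hKc ((hKd.differentiable (by simp)) (slideSign b * t)).hasDerivAt
  have hρ : rho g (ambCurve g K (slideSign b * t)) ≤ 3 / 10 := by
    rw [show ambCurve g K (slideSign b * t) = (K (circlePt (slideSign b * t))).1 from rfl,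
      rho_eq_of_mem_page g hc (hKc _)]
    norm_num
  unfold pageTwistingLoop
  beta_reduce
  rw [hamb, hvel, hpt]
  apply Complex.ext
  · dsimp only
    rw [cplxJ_smul, real_inner_smul_right, inner_add_left, real_inner_smul_left, real_inner_smul_left,
      real_inner_smul_left, real_inner_smul_left, inner_cplxJ_cplxJ]
    ring
  · dsimp only
    rw [inner_add_left, real_inner_smul_left, real_inner_smul_left, real_inner_smul_left, real_inner_smul_left,
      inner_cplxJ_horizNormal_eq_zero hTq, inner_rotField_horizNormal hρ]
    ring

/-- **The page twisting of the fibre framing `d/dε|₀ Φ (uDir b θ, ε reflFibre s θ)` of the re-parametrised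
core `θ ↦ K (uDir b θ)` of the page tube is `s · σ_b`** (the winding number of the ellipse-like twisting
loop, `wind_ellipseLike`). [cite: EtnyreFuller2006, §2] -/
theorem pageTwisting_core {c : ℂ} (hc : ‖c‖ = 1) (hK : Manifold.IsSmoothEmbedding (𝓡 1) (𝓡∂ 4) ∞ K)
    (hKc : ∀ θ, K θ ∈ page g c) (Φ : CircleTube (bBase g).carrier) {κ a : ℝ} (hκ : 0 < κ) (ha : 0 < a)
    (hcore : ∀ ψ, (bBase g).incl (Φ.core ψ) = K ψ)
    (hder : ∀ t : ℝ, HasFDerivAt (fun v : EuclideanSpace ℝ (Fin 2) =>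
        ((bBase g).incl (Φ.toHomeo (circlePt t, v))).1)
      ((EuclideanSpace.proj (𝕜 := ℝ) (0 : Fin 2)).smulRight (a • cplxJ (deriv (ambCurve g K) t)) +
        (EuclideanSpace.proj (𝕜 := ℝ) (1 : Fin 2)).smulRight (κ • rotField g (K (circlePt t)).1)) 0)
    (b : Bool) {s : ℝ} (hs : s ^ 2 = 1) :
    ((pageTwisting g (fun θ => K (uDir b θ))
        (fun θ => mfderiv 𝓘(ℝ, ℝ) (𝓡∂ 4) (fun ε : ℝ => (bBase g).incl (Φ.toHomeo (uDir b θ,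
          ε • reflFibre s (θ : EuclideanSpace ℝ (Fin 2))))) 0 (1 : ℝ)) : ℤ) : ℝ) = s * slideSign b := by
  have hKd := contDiff_ambCurve_top (g := g) hK.contMDiff
  have hK'c : Continuous (deriv (ambCurve g K)) := hKd.continuous_deriv (by simp)
  have hσb := slideSign_eq_or b
  have hs' : s = 1 ∨ s = -1 := mul_self_eq_one_iff.1 ((pow_two s).symm.trans hs)
  have hc0 : c ≠ 0 := fun h => by rw [h, norm_zero] at hc; exact zero_ne_one hc
  -- the point `q(t)` and the velocity `T(t)` at `τ = σ_b t`
  have hqc : Continuous fun t : ℝ => ambCurve g K (slideSign b * t) := hKd.continuous.comp (continuous_const.mul continuous_id)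
  have hTc : Continuous fun t : ℝ => deriv (ambCurve g K) (slideSign b * t) := hK'c.comp (continuous_const.mul continuous_id)
  have hq0 : ∀ t : ℝ, ambCurve g K (slideSign b * t) ≠ 0 := fun t => coe_ne_zero (K (circlePt _))
  have hwq : ∀ t : ℝ, w g (ambCurve g K (slideSign b * t)) ≠ 0 := fun t => by
    rw [show w g (ambCurve g K (slideSign b * t)) = c / 2 from (hKc (circlePt _)).2]
    exact div_ne_zero hc0 two_ne_zero
  have hN : ∀ t : ℝ, 0 < ‖dPhiX g (ambCurve g K (slideSign b * t))‖ ^ 2 + ‖dPhiY (ambCurve g K (slideSign b * t))‖ ^ 2 :=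
    fun t => lt_of_le_of_ne (by positivity) (normSq_dPhi_ne_zero (hq0 t)).symm
  have hA : ContinuousOn (fun t : ℝ => a * ‖deriv (ambCurve g K) (slideSign b * t)‖ ^ 2) (Icc 0 1) :=
    (continuous_const.mul (hTc.norm.pow 2)).continuousOn
  have hB : ContinuousOn (fun t : ℝ => κ * inner ℝ (rotField g (ambCurve g K (slideSign b * t)))
      (cplxJ (deriv (ambCurve g K) (slideSign b * t)))) (Icc 0 1) :=
    (continuous_const.mul ((((contDiff_rotField g).continuous.comp hqc).inner (continuous_cplxJ.comp hTc)))).continuousOn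
  have hD : ContinuousOn (fun t : ℝ => κ * (‖w g (ambCurve g K (slideSign b * t))‖ ^ 2 /
      (‖dPhiX g (ambCurve g K (slideSign b * t))‖ ^ 2 + ‖dPhiY (ambCurve g K (slideSign b * t))‖ ^ 2))) (Icc 0 1) := by
    refine (continuous_const.mul ((((contDiff_w g).continuous.comp hqc).norm.pow 2).div ?_ fun t => (hN t).ne')).continuousOn
    exact (((continuous_dPhiX g).comp hqc).norm.pow 2).add ((continuous_dPhiY.comp hqc).norm.pow 2)
  have hA0 : ∀ t ∈ Icc (0 : ℝ) 1, 0 < a * ‖deriv (ambCurve g K) (slideSign b * t)‖ ^ 2 := fun t _ =>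
    mul_pos ha (pow_pos (norm_pos_iff.2 (deriv_ambCurve_ne_zero hK _)) 2)
  have hD0 : ∀ t ∈ Icc (0 : ℝ) 1, 0 < κ * (‖w g (ambCurve g K (slideSign b * t))‖ ^ 2 /
      (‖dPhiX g (ambCurve g K (slideSign b * t))‖ ^ 2 + ‖dPhiY (ambCurve g K (slideSign b * t))‖ ^ 2)) := fun t _ =>
    mul_pos hκ (div_pos (pow_pos (norm_pos_iff.2 (hwq t)) 2) (hN t))
  have hA1 : a * ‖deriv (ambCurve g K) (slideSign b * 0)‖ ^ 2 = a * ‖deriv (ambCurve g K) (slideSign b * 1)‖ ^ 2 := by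
    rw [deriv_ambCurve_slideSign]
  have hB1 : κ * inner ℝ (rotField g (ambCurve g K (slideSign b * 0))) (cplxJ (deriv (ambCurve g K) (slideSign b * 0))) =
      κ * inner ℝ (rotField g (ambCurve g K (slideSign b * 1))) (cplxJ (deriv (ambCurve g K) (slideSign b * 1))) := by
    rw [deriv_ambCurve_slideSign, ambCurve_slideSign]
  have hD1 : κ * (‖w g (ambCurve g K (slideSign b * 0))‖ ^ 2 /
      (‖dPhiX g (ambCurve g K (slideSign b * 0))‖ ^ 2 + ‖dPhiY (ambCurve g K (slideSign b * 0))‖ ^ 2)) =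
      κ * (‖w g (ambCurve g K (slideSign b * 1))‖ ^ 2 /
      (‖dPhiX g (ambCurve g K (slideSign b * 1))‖ ^ 2 + ‖dPhiY (ambCurve g K (slideSign b * 1))‖ ^ 2)) := by
    rw [ambCurve_slideSign]
  have hform := funext (pageTwistingLoop_core hc hK hKc Φ hcore hder b s)
  unfold pageTwisting
  rw [hform, mul_comm s]
  exact wind_ellipseLike hA hB hD hA0 hD0 hA1 hB1 hD1 hσb hs'

/-! ### §3b Riders: the bookkeeping read directly at a push-off `Φ (uDir b θ, d e₁)` -/

/-- `uDir false` is the identity. [folklore] -/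
theorem uDir_false (θ : sphere (0 : EuclideanSpace ℝ (Fin 2)) 1) : uDir false θ = θ := by
  apply Subtype.ext
  rw [coe_uDir]
  ext i
  fin_cases i <;> simp [slideSign]

/-- `‖c e₁‖ = |c|`. [folklore] -/
theorem norm_smul_planeE1 (c : ℝ) : ‖(c • planeE1 : EuclideanSpace ℝ (Fin 2))‖ = |c| := by
  have h : ‖(c • planeE1 : EuclideanSpace ℝ (Fin 2))‖ ^ 2 = c ^ 2 := by
    rw [EuclideanSpace.real_norm_sq_eq, Fin.sum_univ_two]
    simp
  rw [← Real.sqrt_sq (norm_nonneg _), h, Real.sqrt_sq_eq_abs]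

/-- **The homology shadow of a push-off `θ ↦ Φ (uDir b θ, d e₁)` (`|d| < 1`) of a tube with core `K` is
`± shadow K`**, the sign being the slide direction `b` (`uDir false = id`, `uDir true` = reversal): radial family
to the re-parametrised core. [folklore] -/
theorem shadow_pushoff (Φ : CircleTube (bBase g).carrier) (hcore : ∀ ψ, (bBase g).incl (Φ.core ψ) = K ψ)
    (hK : Continuous K) (b : Bool) {d : ℝ} (hd : |d| < 1)
    (h' : Continuous fun θ : sphere (0 : EuclideanSpace ℝ (Fin 2)) 1 =>
      (bBase g).incl (Φ.toHomeo (uDir b θ, d • planeE1))) :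
    shadow g (fun θ => (bBase g).incl (Φ.toHomeo (uDir b θ, d • planeE1))) h' =
      (if b then -1 else 1 : ℤ) • shadow g K hK := by
  have hKu : Continuous fun θ => K (uDir b θ) := hK.comp (contMDiff_uDir b).continuous
  have hfam : shadow g (fun θ => K (uDir b θ)) hKu =
      shadow g (fun θ => (bBase g).incl (Φ.toHomeo (uDir b θ, d • planeE1))) h' := by
    refine shadow_eq_of_family (fun l θ => (bBase g).incl (Φ.toHomeo (uDir b θ, (l * d) • planeE1))) ?_ hKu h'
      (fun θ => ?_) (fun θ => ?_)
    · have hin : Continuous fun p : ℝ × (sphere (0 : EuclideanSpace ℝ (Fin 2)) 1) =>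
          ((uDir b p.2, (p.1 * d) • planeE1) : (sphere (0 : EuclideanSpace ℝ (Fin 2)) 1) × EuclideanSpace ℝ (Fin 2)) :=
        ((contMDiff_uDir b).continuous.comp continuous_snd).prodMk ((continuous_fst.mul continuous_const).smul continuous_const)
      refine (bBase g).isSmoothEmbedding.contMDiff.continuous.comp_continuousOn
        (Φ.toHomeo.continuousOn.comp hin.continuousOn fun p hp => Φ.mem_source_iff.2 ?_)
      rw [norm_smul_planeE1, abs_mul]
      have hl : |p.1| ≤ 1 := abs_le.2 ⟨by linarith [hp.1.1], hp.1.2⟩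
      nlinarith [abs_nonneg p.1, abs_nonneg d]
    · show (bBase g).incl (Φ.toHomeo (uDir b θ, ((0 : ℝ) * d) • planeE1)) = K (uDir b θ)
      rw [zero_mul, zero_smul, ← CircleTube.core_apply, hcore]
    · show (bBase g).incl (Φ.toHomeo (uDir b θ, ((1 : ℝ) * d) • planeE1)) = _
      rw [one_mul]
  rw [← hfam]
  have key : ∀ (L : sphere (0 : EuclideanSpace ℝ (Fin 2)) 1 → Base g) (hL : Continuous L) (_ : L = K),
      shadow g L hL = shadow g K hK := by
    intro L hL e; subst e; rfl
  cases b
  · rw [key _ hKu (funext fun θ => congrArg K (uDir_false θ))]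
    simp
  · have hrev : ∀ t : ℝ, K (uDir true (circlePt t)) = K (circlePt (-t)) := fun t => by
      rw [uDir_circlePt, show slideSign true = -1 from rfl, neg_one_mul]
    rw [shadow_eq_neg_of_reverse hK hKu hrev]
    simp

/-- A page direction turned by a real angle is again a unit direction. [folklore] -/
theorem norm_exp_mul_eq_one {c : ℂ} (hc : ‖c‖ = 1) (κ x : ℝ) : ‖Complex.exp (Complex.I * κ * x) * c‖ = 1 := by
  rw [norm_mul, Complex.norm_exp, hc, mul_one]
  simp

/-- **The page twisting read directly at a push-off** (rider; needs Z4's PAGES clause): for `|d| < 1` the fibre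
framing `d/dε|₀ Φ (uDir b θ, d e₁ + ε reflFibre s θ)` of the push-off `θ ↦ Φ (uDir b θ, d e₁)` has page twisting
`s · slideSign b` — the radial family of push-offs `Φ (uDir b θ, sin (πλ/2) d e₁)` consists of smoothly embedded
page curves with framings (Z5's `isFramingAlong_tubeCurve`), so no twisting loop vanishes along it
(`pageTwistingLoop_ne_zero_of_isKnotFraming`) and `pageTwisting_eq_of_bundle_family` reduces to the core
(`pageTwisting_core`). [cite: EtnyreFuller2006, §2] -/
theorem pageTwisting_pushoff {c : ℂ} (hc : ‖c‖ = 1) (hK : Manifold.IsSmoothEmbedding (𝓡 1) (𝓡∂ 4) ∞ K)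
    (hKc : ∀ θ, K θ ∈ page g c) (Φ : CircleTube (bBase g).carrier) {κ a : ℝ} (hκ : 0 < κ) (ha : 0 < a)
    (hcore : ∀ ψ, (bBase g).incl (Φ.core ψ) = K ψ)
    (hpages : ∀ (ψ : sphere (0 : EuclideanSpace ℝ (Fin 2)) 1) (v : EuclideanSpace ℝ (Fin 2)), ‖v‖ < 1 →
      (bBase g).incl (Φ.toHomeo (ψ, v)) ∈ page g (Complex.exp (Complex.I * κ * v 1) * c))
    (hder : ∀ t : ℝ, HasFDerivAt (fun v : EuclideanSpace ℝ (Fin 2) =>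
        ((bBase g).incl (Φ.toHomeo (circlePt t, v))).1)
      ((EuclideanSpace.proj (𝕜 := ℝ) (0 : Fin 2)).smulRight (a • cplxJ (deriv (ambCurve g K) t)) +
        (EuclideanSpace.proj (𝕜 := ℝ) (1 : Fin 2)).smulRight (κ • rotField g (K (circlePt t)).1)) 0)
    (b : Bool) {s : ℝ} (hs : s ^ 2 = 1) {d : ℝ} (hd : |d| < 1) :
    ((pageTwisting g (fun θ => (bBase g).incl (Φ.toHomeo (uDir b θ, d • planeE1)))
        (fun θ => mfderiv 𝓘(ℝ, ℝ) (𝓡∂ 4) (fun ε : ℝ => (bBase g).incl (Φ.toHomeo (uDir b θ,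
          d • planeE1 + ε • reflFibre s (θ : EuclideanSpace ℝ (Fin 2))))) 0 (1 : ℝ)) : ℤ) : ℝ) = s * slideSign b := by
  -- the radial family of push-offs with the fibre framings `reflFibre s θ`
  have hw : ContMDiff (𝓘(ℝ, ℝ).prod (𝓡 1)) 𝓘(ℝ, EuclideanSpace ℝ (Fin 2)) ∞
      fun p : ℝ × (sphere (0 : EuclideanSpace ℝ (Fin 2)) 1) => ((Real.sin (π / 2 * p.1) * d) • planeE1 : EuclideanSpace ℝ (Fin 2)) := by
    have h : ContDiff ℝ ∞ fun l : ℝ => ((Real.sin (π / 2 * l) * d) • planeE1 : EuclideanSpace ℝ (Fin 2)) := by fun_prop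
    exact h.contMDiff.comp contMDiff_fst
  have hζ := contMDiff_reflFibre_snd s
  have hw1 : ∀ (l : ℝ) (_ : sphere (0 : EuclideanSpace ℝ (Fin 2)) 1),
      ‖((Real.sin (π / 2 * l) * d) • planeE1 : EuclideanSpace ℝ (Fin 2))‖ < 1 := fun l _ => by
    rw [norm_smul_planeE1, abs_mul]
    nlinarith [Real.abs_sin_le_one (π / 2 * l), abs_nonneg (Real.sin (π / 2 * l)), abs_nonneg d]
  have hζ0 : ∀ (_ : ℝ) (θ : sphere (0 : EuclideanSpace ℝ (Fin 2)) 1), reflFibre s (θ : EuclideanSpace ℝ (Fin 2)) ≠ 0 :=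
    fun _ θ => reflFibre_coe_ne_zero hs θ
  have hfr := isFramingAlong_tubeCurve (W := Base g) Φ b (w := fun l _ =>
    ((Real.sin (π / 2 * l) * d) • planeE1 : EuclideanSpace ℝ (Fin 2))) (ζ := fun _ θ => reflFibre s (θ : EuclideanSpace ℝ (Fin 2)))
    hw hζ hw1 hζ0
  -- the regularity hypotheses of `pageTwisting_eq_of_bundle_family`
  have hKν := (continuous_tubeCurveFraming_uncurry (W := Base g) Φ b (w := fun l _ =>
    ((Real.sin (π / 2 * l) * d) • planeE1 : EuclideanSpace ℝ (Fin 2))) (ζ := fun _ θ => reflFibre s (θ : EuclideanSpace ℝ (Fin 2)))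
    hw hζ hw1).continuousOn (s := Icc (0 : ℝ) 1 ×ˢ univ)
  have hF : ContDiff ℝ 1 fun p : ℝ × ℝ => ambCurve g (tubeCurve (W := Base g) Φ b (fun l _ =>
      ((Real.sin (π / 2 * l) * d) • planeE1 : EuclideanSpace ℝ (Fin 2))) p.1) p.2 := by
    have h1 : ContMDiff (𝓘(ℝ, ℝ).prod 𝓘(ℝ, ℝ)) (𝓡∂ 4) ∞ fun p : ℝ × ℝ => tubeCurve (W := Base g) Φ b (fun l _ =>
        ((Real.sin (π / 2 * l) * d) • planeE1 : EuclideanSpace ℝ (Fin 2))) p.1 (circlePt p.2) :=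
      (contMDiff_tubeCurve_uncurry (W := Base g) Φ b hw hw1).comp (contMDiff_fst.prodMk (contMDiff_circlePt.comp contMDiff_snd))
    have h2 : ContMDiff (𝓘(ℝ, ℝ).prod 𝓘(ℝ, ℝ)) (𝓡 4) 1 fun p : ℝ × ℝ => ambCurve g (tubeCurve (W := Base g) Φ b (fun l _ =>
        ((Real.sin (π / 2 * l) * d) • planeE1 : EuclideanSpace ℝ (Fin 2))) p.1) p.2 :=
      ((RegularSublevel.contMDiff_incl (isRegularLevel_rho g)).comp h1).of_le (by simp)
    rw [← contMDiff_iff_contDiff, modelWithCornersSelf_prod, ← chartedSpaceSelf_prod]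
    exact h2
  have hdv := continuousOn_deriv_of_contDiff_family hF (Icc (0 : ℝ) 1 ×ˢ univ)
  have hne : ∀ l ∈ Icc (0 : ℝ) 1, ∀ t ∈ Icc (0 : ℝ) 1, pageTwistingLoop g (tubeCurve (W := Base g) Φ b (fun l _ =>
      ((Real.sin (π / 2 * l) * d) • planeE1 : EuclideanSpace ℝ (Fin 2))) l) (tubeCurveFraming (W := Base g) Φ b (fun l _ =>
      ((Real.sin (π / 2 * l) * d) • planeE1 : EuclideanSpace ℝ (Fin 2))) (fun _ θ => reflFibre s (θ : EuclideanSpace ℝ (Fin 2))) l) t ≠ 0 := by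
    intro l hl t _
    have hpl : ∀ θ : sphere (0 : EuclideanSpace ℝ (Fin 2)) 1, tubeCurve (W := Base g) Φ b (fun l _ =>
        ((Real.sin (π / 2 * l) * d) • planeE1 : EuclideanSpace ℝ (Fin 2))) l θ ∈
        page g (Complex.exp (Complex.I * κ * (((Real.sin (π / 2 * l) * d) • planeE1 : EuclideanSpace ℝ (Fin 2)) 1)) * c) :=
      fun θ => hpages (uDir b θ) _ (hw1 l θ)
    exact pageTwistingLoop_ne_zero_of_isKnotFraming (norm_exp_mul_eq_one hc κ _)
      (isSmoothEmbedding_tubeCurve (W := Base g) Φ b hw hw1 l) hpl (hfr.isKnotFraming l hl) t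
  have key := pageTwisting_eq_of_bundle_family hKν hdv hne
  -- the two ends of the family
  have e0K : tubeCurve (W := Base g) Φ b (fun l _ => ((Real.sin (π / 2 * l) * d) • planeE1 : EuclideanSpace ℝ (Fin 2))) 0 =
      fun θ => K (uDir b θ) := by
    funext θ
    show (bBase g).incl (Φ.toHomeo (uDir b θ, (Real.sin (π / 2 * (0 : ℝ)) * d) • planeE1)) = _
    rw [mul_zero, Real.sin_zero, zero_mul, zero_smul, ← CircleTube.core_apply, hcore]
  have e0ν : tubeCurveFraming (W := Base g) Φ b (fun l _ => ((Real.sin (π / 2 * l) * d) • planeE1 : EuclideanSpace ℝ (Fin 2)))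
      (fun _ θ => reflFibre s (θ : EuclideanSpace ℝ (Fin 2))) 0 =
      fun θ => mfderiv 𝓘(ℝ, ℝ) (𝓡∂ 4) (fun ε : ℝ => (bBase g).incl (Φ.toHomeo (uDir b θ,
        ε • reflFibre s (θ : EuclideanSpace ℝ (Fin 2))))) 0 (1 : ℝ) := by
    funext θ
    have e : (fun ε : ℝ => (bBase g).incl (Φ.toHomeo (uDir b θ, (Real.sin (π / 2 * (0 : ℝ)) * d) • planeE1 +
        ε • reflFibre s (θ : EuclideanSpace ℝ (Fin 2))))) =
        fun ε : ℝ => (bBase g).incl (Φ.toHomeo (uDir b θ, ε • reflFibre s (θ : EuclideanSpace ℝ (Fin 2)))) := by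
      funext ε
      rw [mul_zero, Real.sin_zero, zero_mul, zero_smul, zero_add]
    exact congrArg (fun f : ℝ → Base g => mfderiv 𝓘(ℝ, ℝ) (𝓡∂ 4) f 0 (1 : ℝ)) e
  have e1K : tubeCurve (W := Base g) Φ b (fun l _ => ((Real.sin (π / 2 * l) * d) • planeE1 : EuclideanSpace ℝ (Fin 2))) 1 =
      fun θ => (bBase g).incl (Φ.toHomeo (uDir b θ, d • planeE1)) := by
    funext θ
    show (bBase g).incl (Φ.toHomeo (uDir b θ, (Real.sin (π / 2 * (1 : ℝ)) * d) • planeE1)) = _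
    rw [mul_one, Real.sin_pi_div_two, one_mul]
  have e1ν : tubeCurveFraming (W := Base g) Φ b (fun l _ => ((Real.sin (π / 2 * l) * d) • planeE1 : EuclideanSpace ℝ (Fin 2)))
      (fun _ θ => reflFibre s (θ : EuclideanSpace ℝ (Fin 2))) 1 =
      fun θ => mfderiv 𝓘(ℝ, ℝ) (𝓡∂ 4) (fun ε : ℝ => (bBase g).incl (Φ.toHomeo (uDir b θ,
        d • planeE1 + ε • reflFibre s (θ : EuclideanSpace ℝ (Fin 2))))) 0 (1 : ℝ) := by
    funext θ
    have e : (fun ε : ℝ => (bBase g).incl (Φ.toHomeo (uDir b θ, (Real.sin (π / 2 * (1 : ℝ)) * d) • planeE1 +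
        ε • reflFibre s (θ : EuclideanSpace ℝ (Fin 2))))) =
        fun ε : ℝ => (bBase g).incl (Φ.toHomeo (uDir b θ, d • planeE1 + ε • reflFibre s (θ : EuclideanSpace ℝ (Fin 2)))) := by
      funext ε
      rw [mul_one, Real.sin_pi_div_two, one_mul]
    exact congrArg (fun f : ℝ → Base g => mfderiv 𝓘(ℝ, ℝ) (𝓡∂ 4) f 0 (1 : ℝ)) e
  have key' : pageTwisting g (fun θ => K (uDir b θ)) (fun θ => mfderiv 𝓘(ℝ, ℝ) (𝓡∂ 4)
      (fun ε : ℝ => (bBase g).incl (Φ.toHomeo (uDir b θ, ε • reflFibre s (θ : EuclideanSpace ℝ (Fin 2))))) 0 (1 : ℝ)) =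
      pageTwisting g (fun θ => (bBase g).incl (Φ.toHomeo (uDir b θ, d • planeE1)))
        (fun θ => mfderiv 𝓘(ℝ, ℝ) (𝓡∂ 4) (fun ε : ℝ => (bBase g).incl (Φ.toHomeo (uDir b θ,
          d • planeE1 + ε • reflFibre s (θ : EuclideanSpace ℝ (Fin 2))))) 0 (1 : ℝ)) := by
    rw [← e0K, ← e0ν, ← e1K, ← e1ν]
    exact key
  rw [← key']
  exact pageTwisting_core hc hK hKc Φ hκ ha hcore hder b hs

/-! ### §4 Registered helper: the page twisting at the core (the text agreed with the assembler Y1) -/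

/-- **Registered helper `helper_belt_coreTwisting` (node T3c-1 of NF6 `stub_steinRealisation`, bookkeeping (4)
of stage (3d), wave 4, lead c5; statement agreed with the assembler Y1).**  For a smooth embedding `K` into
the page `page g c` (`‖c‖ = 1`) and a circle tube `Φ` of `∂ Base g` with Z4's CORE clause `Φ (ψ, 0) = K ψ`
and FIBRE DERIVATIVE clause `d/dv|₀ Φ (e^{2πit}, v) = v₀ · r · iK'(t) + v₁ · κ · rot (K (e^{2πit}))`
(`κ, r > 0`), a slide direction `b` and a sign `s` (`s² = 1`), the fibre framing
`θ ↦ d/dε|₀ Φ (uDir b θ, ε reflFibre s θ)` of the re-parametrised core `θ ↦ K (uDir b θ)` has page twisting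
`s · slideSign b`. [cite: EtnyreFuller2006, §2] -/
theorem helper_belt_coreTwisting :
    ∀ (g : ℕ) (c : ℂ) (K : Metric.sphere (0 : EuclideanSpace ℝ (Fin 2)) 1 →
        Literature.Topology.FourManifolds.LefschetzBase.Base g),
      ‖c‖ = 1 → Manifold.IsSmoothEmbedding (𝓡 1) (𝓡∂ 4) ∞ K →
      (∀ θ, K θ ∈ Literature.Topology.FourManifolds.LefschetzBase.page g c) →
      ∀ (κ r : ℝ) (Φ : Literature.Topology.FourManifolds.CircleTube
        (Literature.Topology.FourManifolds.LefschetzBase.bBase g).carrier),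
      0 < κ → 0 < r →
      (∀ ψ, (Literature.Topology.FourManifolds.LefschetzBase.bBase g).incl (Φ.core ψ) = K ψ) →
      (∀ t : ℝ, HasFDerivAt (fun v : EuclideanSpace ℝ (Fin 2) =>
          ((Literature.Topology.FourManifolds.LefschetzBase.bBase g).incl
            (Φ.toHomeo (Literature.Topology.FourManifolds.circlePt t, v))).1)
        ((EuclideanSpace.proj (𝕜 := ℝ) (0 : Fin 2)).smulRight
            (r • Literature.Topology.FourManifolds.LefschetzBase.cplxJ
              (deriv (Literature.Topology.FourManifolds.LefschetzBase.ambCurve g K) t)) +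
          (EuclideanSpace.proj (𝕜 := ℝ) (1 : Fin 2)).smulRight
            (κ • Summit.SmoothPoincare4.SmoothPoincare4.Theorems.AcyclicBisectionExists.ModpBraidOrbits.rotField
              g (K (Literature.Topology.FourManifolds.circlePt t)).1)) 0) →
      ∀ (b : Bool) (s : ℝ), s ^ 2 = 1 →
        ((Literature.Topology.FourManifolds.LefschetzBase.pageTwisting g
            (fun θ => K (Summit.SmoothPoincare4.SmoothPoincare4.Theorems.AcyclicBisectionExists.ModpBraidOrbits.uDir b θ))
            (fun θ => mfderiv 𝓘(ℝ, ℝ) (𝓡∂ 4)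
              (fun ε : ℝ => (Literature.Topology.FourManifolds.LefschetzBase.bBase g).incl
                (Φ.toHomeo (Summit.SmoothPoincare4.SmoothPoincare4.Theorems.AcyclicBisectionExists.ModpBraidOrbits.uDir b θ,
                  ε • Summit.SmoothPoincare4.SmoothPoincare4.Theorems.AcyclicBisectionExists.ModpBraidOrbits.reflFibre
                    s (θ : EuclideanSpace ℝ (Fin 2)))))
              0 (1 : ℝ)) : ℤ) : ℝ) =
          s * Summit.SmoothPoincare4.SmoothPoincare4.Theorems.AcyclicBisectionExists.ModpBraidOrbits.slideSign b := by
  intro g c K hc hK hKc κ r Φ hκ hr hcore hder b s hs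
  exact pageTwisting_core hc hK hKc Φ hκ hr hcore hder b hs

end Summit.SmoothPoincare4.SmoothPoincare4.Theorems.AcyclicBisectionExists.ModpBraidOrbits

end
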